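import Summits.ResolutionOfSingularities.ResolutionOfSingularities.Theorems.HilbertSamuelEliminationSigmaMaxModificationsCorridor3WLadderMovingTwoGradeZero
import HarnessLib

/-!
# [OURS · L1 W4.2] The THIRD DOOR of the characteristic-2 row `stub_Wlow3M_two` through its named socket
# `IsoLowDirDimTerminatesFreeM`, and the (H-β) ASSEMBLY SHAPE: the row from the residue R_β = {`KeyTheorem640_isolated`,
# `Corollary637_geomDir`} + the (F1♯)-shadow `Theorem314_geomDir` + three OURS CONSTRUCTIONS (crux chain w42, line `w_ladder` v6;
# `--supports stmt-ResolutionOfSingularities-19249`, helper)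

Stub worker res-L1-w42-stub-3 (gen 3); CHAIN v3.9a (M) «(G) OUTCOME (ii) OF RECORD: honest floor R_β = {KeyTheorem640_isolated,
Corollary637_geomDir} + T7's 2.14♯; stub-3's target (M-a) = the OURS CONSTRUCTIONS so that the row is closed modulo EXACTLY R_β;
RESHAPE clause (H-β)». This file names the constructions and proves the assembly:

* `isoLowDirDimTerminatesFreeM_of_doors` — **the all-origin third-door socket `IsoLowDirDimTerminatesFreeM p` (`…MovingTwoDefs`, twin of
  lead-1's `IsoLowDirDimTerminatesQM`) from its two doors**: `e = 0` by the (F1♯)-shadow `Theorem314_geomDir`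
  (`noMovingNearChainFrom_of_dirDim_eq_zero_geomDir`, p503441 — no isolation needed), `e = 1` by the OURS carrier `Corollary637_geomDir`
  through the CHARACTERISTIC-FREE POINT-SEQUENCE EXTRACTION at an isolated stage (stated INLINE as a hypothesis — construction (C1),
  finite-segment bridge B1′ in the `e = 1` shape; stub-2's char-free B1′ is expected to discharge it);
* `wlowUnitsM_of_extraction_freeSocket` / `wlowM_assembled_freeSocket` — the units-half / `WlowM p` with the NAMED socket in place of the
  inline one of `wlowUnitsM_of_extraction_free` (p502286);
* **`wlow3TwoM_of_residue_and_constructions`** — THE (H-β) SHAPE: `∀ p, p.Prime → Wlow3TwoM p` from the residue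
  `KeyTheorem640_isolated`, `Corollary637_geomDir`, the shadow `Theorem314_geomDir`, and the constructions (C1) point-sequence extraction
  at `2` (inline), (C2) `UnitTowerExtractionFreeM 2`, (C3) `WlowStrataM 2` (stub-4's G1′, Q-free). When (C1)–(C3) are PROVED, this is
  plan-1's `wlow3TwoM_of_residue` modulo the typing of 2.14♯ ⇒ `Theorem314_geomDir` (T7, res-type-001).

OURS (cell res-hironaka, slot W4.2); NOT statements of the manuscript [Hironaka2017] nor of [CossartJannsenSaito2020];
AI-drafted, weaker than expert review. References: CJS LNM 2270 Thm. 3.14, Def. 6.34, Cor. 6.37, Def. 6.38/6.39, Thm. 6.40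
[CossartJannsenSaito2020]; lead-1's `…Corridor3WLadderMovingIsoLowQ`; CHAIN v3.9a (M)/(H-β).
-/

noncomputable section

-- namespace `…Corridor3.Moving` re-enters `…Corridor3` (module convention of the Moving files)
set_option linter.dupNamespace false

open CategoryTheory AlgebraicGeometry TopologicalSpace IsLocalRing
open Literature.AlgebraicGeometry.Resolution Literature.RingTheory.HilbertSamuel
open Summit.ResolutionOfSingularities.ResolutionOfSingularities.Theorems.CampaignW42
open Literature.AlgebraicGeometry.CossartJannsenSaito2020
open Summit.ResolutionOfSingularities.ResolutionOfSingularities.Theorems.SigmaMaxModificationsCorridor3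

namespace Summit.ResolutionOfSingularities.ResolutionOfSingularities.Theorems.SigmaMaxModificationsCorridor3.Moving

/-! ## The socket from its two doors -/

/-- **THE THIRD-DOOR SOCKET `IsoLowDirDimTerminatesFreeM p` FROM ITS DOORS (PROVED reduction)**: `e = 0` by the (F1♯)-shadow
`Theorem314_geomDir`; `e = 1` by the OURS carrier `Corollary637_geomDir` applied to the tower produced by a characteristic-free
point-sequence extraction at the isolated stage (construction (C1), hypothesis `hext`: from a reached isolated stage with `e = 1`,
`ē ≤ 2` and a MOVING grade-`ē ≤ 2` chain out of it, an infinite fundamental sequence (Def. 6.34, `m = ⊤`) on a tower in the key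
setting starting at an isolated point with `e = 1` and (F1♯)). [cite: CossartJannsenSaito2020, Cor. 6.37, Thm. 3.14, Def. 6.34] -/
theorem isoLowDirDimTerminatesFreeM_of_doors {p : ℕ} (hF : Theorem314_geomDir.{0}) (hC : Corollary637_geomDir.{0})
    (hext : ∀ (R : ∀ S : Scheme.{0}, CentreSeq S → Prop), OracleFunctional R → OracleAdmissible R →
      ∀ (ν : ℕ → ℕ) (X : Scheme.{0}) [IsLocallyNoetherian X] (x : X), IsMaximalOrigin p 3 ν X x →
      ∀ s : MarkedStage.{0}, Reaches R 3 ν (MarkedStage.init X x) s → Iso 3 s → dirDim s = 1 → s.geomDirDim ≤ 2 →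
      ∀ c : ℕ → MarkedStage.{0}, Reaches R 3 ν s (c 0) → (∀ n, CanonicalNearStep R 3 ν (c n) (c (n + 1))) →
        (∀ n, (c n).geomDirDim ≤ 2) → (∀ n, ∃ m, n ≤ m ∧ (c m).IsBlownUp R 3 ν) →
        ∃ (T : BlowupTower.{0}) (x₀ : T.X 0), KeySetting T 3 ∧ @GeomDirHypothesis (T.X 0) (T.ln 0) x₀ ∧
          IsFundamentalSequence T 3 x₀ ⊤ ∧ @IsIsolatedInHSMaxLocus (T.X 0) (T.ln 0) 3 x₀ ∧ T.dirDimAt 0 x₀ = 1) :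
    IsoLowDirDimTerminatesFreeM p := by
  intro R hRf hRa ν X _ x hX s hreach hiso hdir hē
  rintro ⟨c, h0, hstep, hG, hmov⟩
  rcases Nat.lt_or_ge (dirDim s) 1 with hlt | hge
  · have he : dirDim s = 0 := by omega
    exact noMovingNearChainFrom_of_dirDim_eq_zero_geomDir hF hRf hRa hX hreach he hē (fun t => t.geomDirDim ≤ 2)
      ⟨c, h0, hstep, hG, hmov⟩
  · have he : dirDim s = 1 := le_antisymm hdir hge
    obtain ⟨T, x₀, hset, hgeo, hFS, hisoT, he1⟩ := hext R hRf hRa ν X x hX s hreach hiso he hē c h0 hstep hG hmov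
    exact lt_irrefl _ (hC T 3 x₀ ⊤ hset hgeo hFS hisoT he1).1

/-! ## The units-half and `WlowM` through the named socket -/

/-- **UNITS-half `WlowUnitsM p` through the NAMED socket** (all primes, all origins): `KeyTheorem640_isolated` + `IsoLowDirDimTerminatesFreeM p`
+ `UnitTowerExtractionFreeM p` (the proof of `wlowUnitsM_of_extraction_free` with the socket applied to the grade-`ē ≤ 2` tail).
[cite: CossartJannsenSaito2020, Thm. 6.40, Cor. 6.37] -/
theorem wlowUnitsM_of_extraction_freeSocket {p : ℕ} (hK : KeyTheorem640_isolated.{0}) (hlow : IsoLowDirDimTerminatesFreeM p)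
    (hext : UnitTowerExtractionFreeM p) : WlowUnitsM p := by
  intro R hRf hRa ν X _ x hX
  rintro ⟨c, h0, hstep, hG, hmov, hrec⟩
  by_cases hlowstage : ∃ m, Iso 3 (c m) ∧ dirDim (c m) ≤ 1
  · obtain ⟨m, hiso, hdir⟩ := hlowstage
    exact hlow R hRf hRa ν X x hX (c m) (reaches_chain h0 hstep m) hiso hdir (hG m)
      ⟨fun n => c (m + n), Relation.ReflTransGen.refl, fun n => hstep (m + n), fun n => hG (m + n), io_shift hmov m⟩
  · push Not at hlowstage
    have he : ∀ n, Iso 3 (c n) → dirDim (c n) = 2 ∧ (c n).geomDirDim = 2 := by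
      intro n hiso
      have h1 := hlowstage n hiso
      have h2 := dirDim_le_geomDirDim (c n)
      have h3 := hG n
      exact ⟨by omega, by omega⟩
    obtain ⟨T, len, pt, hset, hchain, hisoT⟩ := hext R hRf hRa ν X x hX c h0 hstep hG hmov hrec he
    exact hK T 3 len pt hset hchain hisoT

/-- **`WlowM p` through the named socket** (+ the strata-half). [cite: CossartJannsenSaito2020, Thm. 6.40, Cor. 6.37, Thm. 6.35] -/
theorem wlowM_assembled_freeSocket {p : ℕ} (hK : KeyTheorem640_isolated.{0}) (hlow : IsoLowDirDimTerminatesFreeM p)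
    (hext : UnitTowerExtractionFreeM p) (hS : WlowStrataM p) : WlowM p :=
  maxOriginNoMovingNearChainAt_of_recurrence hS (wlowUnitsM_of_extraction_freeSocket hK hlow hext)

/-! ## The (H-β) assembly shape: residue + shadow + constructions -/

/-- **THE CHARACTERISTIC-2 ROW FROM THE RESIDUE R_β, THE (F1♯)-SHADOW, AND THREE OURS CONSTRUCTIONS (PROVED assembly; the (H-β)
shape of CHAIN v3.9a).** Binders (OURS CLAIMS, correct per two readings of CJS Chs. 6–14, unprinted as theorems):
`KeyTheorem640_isolated` (char-free Thm. 6.40 at isolated unit starts), `Corollary637_geomDir` (Cor. 6.37 under (F1♯)),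
`Theorem314_geomDir` (Thm. 3.14's numerical shadow under (F1♯) — follows from 2.14♯, T7). Constructions (OURS, to be PROVED; here
hypotheses): (C1) the characteristic-free point-sequence extraction at isolated `e = 1` stages of W-low chains at the prime `2` (inline),
(C2) `UnitTowerExtractionFreeM 2` (units bridge without the `CharHypothesis` conjunct), (C3) `WlowStrataM 2` (G1′). Every other prime is
vacuous (`stub_Wlow3M_two_of_two`). [folklore] -/
theorem wlow3TwoM_of_residue_and_constructions (hK : KeyTheorem640_isolated.{0}) (hC : Corollary637_geomDir.{0})
    (hF : Theorem314_geomDir.{0})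
    (hext1 : ∀ (R : ∀ S : Scheme.{0}, CentreSeq S → Prop), OracleFunctional R → OracleAdmissible R →
      ∀ (ν : ℕ → ℕ) (X : Scheme.{0}) [IsLocallyNoetherian X] (x : X), IsMaximalOrigin 2 3 ν X x →
      ∀ s : MarkedStage.{0}, Reaches R 3 ν (MarkedStage.init X x) s → Iso 3 s → dirDim s = 1 → s.geomDirDim ≤ 2 →
      ∀ c : ℕ → MarkedStage.{0}, Reaches R 3 ν s (c 0) → (∀ n, CanonicalNearStep R 3 ν (c n) (c (n + 1))) →
        (∀ n, (c n).geomDirDim ≤ 2) → (∀ n, ∃ m, n ≤ m ∧ (c m).IsBlownUp R 3 ν) →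
        ∃ (T : BlowupTower.{0}) (x₀ : T.X 0), KeySetting T 3 ∧ @GeomDirHypothesis (T.X 0) (T.ln 0) x₀ ∧
          IsFundamentalSequence T 3 x₀ ⊤ ∧ @IsIsolatedInHSMaxLocus (T.X 0) (T.ln 0) 3 x₀ ∧ T.dirDimAt 0 x₀ = 1)
    (hext2 : UnitTowerExtractionFreeM 2) (hS : WlowStrataM 2) : ∀ p : ℕ, p.Prime → Wlow3TwoM.{0} p :=
  stub_Wlow3M_two_of_two
    (wlow3TwoM_of_wlowM (wlowM_assembled_freeSocket hK (isoLowDirDimTerminatesFreeM_of_doors hF hC hext1) hext2 hS))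

/-- **The same assembly for EVERY prime from prime-indexed constructions** — both registered W-low rows at once (the regime cut is
bookkeeping). [folklore] -/
theorem wlow_rows_of_residue_and_constructions (hK : KeyTheorem640_isolated.{0}) (hC : Corollary637_geomDir.{0})
    (hF : Theorem314_geomDir.{0})
    (hext1 : ∀ p : ℕ, p.Prime → ∀ (R : ∀ S : Scheme.{0}, CentreSeq S → Prop), OracleFunctional R → OracleAdmissible R →
      ∀ (ν : ℕ → ℕ) (X : Scheme.{0}) [IsLocallyNoetherian X] (x : X), IsMaximalOrigin p 3 ν X x →
      ∀ s : MarkedStage.{0}, Reaches R 3 ν (MarkedStage.init X x) s → Iso 3 s → dirDim s = 1 → s.geomDirDim ≤ 2 →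
      ∀ c : ℕ → MarkedStage.{0}, Reaches R 3 ν s (c 0) → (∀ n, CanonicalNearStep R 3 ν (c n) (c (n + 1))) →
        (∀ n, (c n).geomDirDim ≤ 2) → (∀ n, ∃ m, n ≤ m ∧ (c m).IsBlownUp R 3 ν) →
        ∃ (T : BlowupTower.{0}) (x₀ : T.X 0), KeySetting T 3 ∧ @GeomDirHypothesis (T.X 0) (T.ln 0) x₀ ∧
          IsFundamentalSequence T 3 x₀ ⊤ ∧ @IsIsolatedInHSMaxLocus (T.X 0) (T.ln 0) 3 x₀ ∧ T.dirDimAt 0 x₀ = 1)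
    (hext2 : ∀ p : ℕ, p.Prime → UnitTowerExtractionFreeM p) (hS : ∀ p : ℕ, p.Prime → WlowStrataM p) :
    (∀ p : ℕ, p.Prime → Wlow3CharM.{0} p) ∧ (∀ p : ℕ, p.Prime → Wlow3TwoM.{0} p) :=
  ⟨fun p hp => wlow3CharM_of_wlowM
      (wlowM_assembled_freeSocket hK (isoLowDirDimTerminatesFreeM_of_doors hF hC (hext1 p hp)) (hext2 p hp) (hS p hp)),
   fun p hp => wlow3TwoM_of_wlowM
      (wlowM_assembled_freeSocket hK (isoLowDirDimTerminatesFreeM_of_doors hF hC (hext1 p hp)) (hext2 p hp) (hS p hp))⟩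

end Summit.ResolutionOfSingularities.ResolutionOfSingularities.Theorems.SigmaMaxModificationsCorridor3.Moving

end
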